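import Literature.MathematicalPhysics.QuantumFieldTheory.Balaban1983to89.B11Eq44CKernelColumnTower
import Literature.MathematicalPhysics.QuantumFieldTheory.Balaban1983to89.B7Prop7KernelBackgroundModulusLevels

/-!
# `Balaban1983to89.B11Eq44CKernelTowerTwoBackgrounds` — T. Bałaban, *The variational problem and background fields in renormalization group method for lattice gauge theories*,
# Commun. Math. Phys. **102** (1985) 277–309 [Balaban1985Variational] (44) p. 285 (the remainder `C = C_k`), (73) p. 289, Prop. 6 (117) p. 295; [Balaban1985Averaging] Prop. 5 (157)
# p. 42, Prop. 7 p. 43: **THE KERNEL LETTER OF `C_k` BETWEEN TWO CARRIERS (115) — BACKGROUND `U` vs THE VACUUM, TWO FIELDS — PER ENTRY, WITH THE LOCALITY FACTOR `L^{−kd}`** — for `Y`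
# in the `(115)`-ball of radius `ρ` over `∇_U`'s carrier and `Y′` in the half ball over the vacuum's carrier, with bond functions `A₁, A₂`:
# `‖(DC_k(U)(Y)·Xδ_b)(c) − (DC_k(1)(Y′)·Xδ_b)(c)‖ ≤ ((6∕(Lᵏρ′))(Lᵏαη) + (24Lᵏ∕ρ)·δ_f)·C₃(Lᵏ)²(ρ∕Lᵏ)(η‖X‖)·Σ_t kerQdd(c̃; b̃ + Pt)` (`δ_f ≥ η·sup|A₁ − A₂|`) — the identity
# `B11Eq44CKernelColumnTower.fderiv_Cblockk_single` at `U` and at `1` (sum over the `2^d` period images of [4] Prop. 5's line derivatives) + this generation's B7-level bricks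
# `B7Prop7KernelBackgroundModulusLevels.norm_dCov_sub_flat_le` (background part, Cauchy in the background on `prop5_cplx_157_uniform`) and `norm_dCov_flat_sub_le` (field part), zero
# off the box.  The letter `δg` of this generation's `B11Eq73KernelColumnsTwoBackgrounds` for the chain's Sect. C letter `C_k` (its coarse column `δG` by
# `B7Eq141TorusImagesCount.sum_images_kerQdd_le`: `Σ_c Σ_t kerQdd ≤ 2^d·2d·L^{−kd}`).  NE9 crux-team LEAF PROVER 01 (`b2b-balaban-t4-ne9-formalise-leaf-01`), gen 105; cell
# `pub-balaban`∕`t4`, row NE9, bears_on R4/N22; composition BY NAME; nothing printed is a hypothesis beyond Props. 5∕7's regime DISPLAYED as smallness inequalities.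
# WHAT IS PROVED (sorry-free; 0 `def`): `perCfg_const_one`, **`norm_fderiv_Cck_sub_flat_single_apply_le`**.  HONEST SCOPE: [folklore] bookkeeping over LANDED bricks; crude constants; the
# flat base only; «NE9 ⇐ the named binders»; NE9 NOT PRINTED ∕ NOT PROVED; spine PROVED 0∕9; rung (B)+1 finite T⁴ — NOT infinite volume, NOT mass gap, NOT BetaPertH, NOT Clay.  HONEST
# DEPENDENCY: continuum YM on T⁴ ⇐ BetaPertH ∧ nine spine estimates (0/9 proved); BetaPertH ⇐ (D1) ∧ (D4) ∧ CAP+tail; G-an2-4 gates asym, D1 and NE2/3/4.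

statement-level skeleton of published theorems with citation tags; proofs where landed; nothing here is a claim about the Yang–Mills mass gap
-/

noncomputable section

open scoped BigOperators
open Finset Metric Set

namespace Literature.MathematicalPhysics.QuantumFieldTheory.Balaban1983to89.B11Eq44CKernelTowerTwoBackgrounds

open B7Prop1Local (InBox AgreeOn loK bondHiK)
open B7Prop2Explicit (pdev AvgClosed C0 c2')
open B7Prop3Flat (c3)
open B7Prop5Flat (bump BondIn)
open B7Prop4GeneralLevels (logCovIter linCovIter)
open B7Prop5GeneralOperators (kerQdd kerQdd_of_bondIn kerQdd_of_not_bondIn kerQdd_nonneg)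
open B7Prop5GeneralInduction (CCovIter dCov)
open B7Prop5CplxLevels (epsCplx tauCplx C3Cplx)
open B9Eq315QTorus (perSite perCfg perCfg_apply)
open B9Eq315QTorusOnto (liftSite periodVec)
open B9Eq315QTower (towerP towerP_apply)
open B11Eq44COperatorTower (Cblockk Cblockk_apply analyticAt_Cblockk norm_perCfg_smul_le)
open B11Eq44CLetterTower (Cck equiv_Cck_apply eta_mul_norm_le_of_weight_k smallness_mono analyticOnNhd_Cck)
open B11Eq44CKernelColumnTower (fderiv_Cblockk_single)
open B7Prop7KernelBackgroundModulusLevels (norm_dCov_sub_flat_le norm_dCov_flat_sub_le dCov_sub_flat_eq_zero_off dCov_flat_eq_zero_off)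
open B11Eq115Space
open B11Eq90Transpose (single115 flat115_single115)
open B9SectCLatticeCarrier (Bond)
open B4Sect5Torus (TSite)

export B7Prop1Explicit (Site)

variable {d : ℕ}

section Prelim

variable {𝔸 : Type*} [NormedRing 𝔸]

/-- The periodic extension of the vacuum IS the vacuum of `ℤ^d`. [cite: Balaban1985Averaging, (1) p.17] -/
theorem perCfg_const_one (L : ℕ) [NeZero L] (m : Fin d → ℕ) [∀ i, NeZero (m i)] (k : ℕ) :
    perCfg (towerP L m k) (fun _ : Bond d (towerP L m k) => (1 : 𝔸ˣ)) = 1 :=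
  funext fun _ => funext fun _ => rfl

/-- (52) at the vacuum of `ℤ^d`: the plaquette deviation vanishes. [cite: Balaban1985Averaging, Proposition 2 (52) p.26, (9) p.18] -/
private theorem hol_one : ∀ (x : Site d) (w : List (B7Prop1Explicit.Letter d)), B7Prop1Explicit.hol (1 : Site d → Fin d → 𝔸ˣ) x w = 1
  | _, [] => rfl
  | x, l :: w => by rw [B7Prop1Explicit.hol_cons, hol_one (x + l.vec) w, mul_one]; simp [B7Prop1Explicit.stepHol]

end Prelim

section Letter

variable {𝔸 : Type*} [NormedRing 𝔸] [NormedAlgebra ℂ 𝔸] [CompleteSpace 𝔸] [NormOneClass 𝔸] [FiniteDimensional ℂ 𝔸]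
  (L : ℕ) [NeZero L] (m : Fin d → ℕ) [∀ i, NeZero (m i)] (η : ℝ) (k : ℕ) (U : Bond d (towerP L m k) → 𝔸ˣ)
  {κ' : Type*} [Fintype κ'] (lev₀ : Bond d (towerP L m k) → ℕ) (lev₁ : κ' → ℕ)
  (Dc₁ Dc₂ : (Bond d (towerP L m k) → 𝔸) →ₗ[ℂ] (κ' → 𝔸)) (levB : Bond d m → ℕ) [Fact (0 < (L : ℝ))] [Fact (0 < η)]
  (hL : 2 ≤ L) {G : Subgroup 𝔸ˣ} (hG : AvgClosed d L G)
  (hU : ∀ (x : Site d) (κ : Fin d), perCfg (towerP L m k) U x κ ∈ G) {α₀ : ℝ} (hα : 0 < α₀)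
  (hα3 : C0 d * α₀ ≤ 1 / 3) (hα8 : 8 * α₀ ≤ c2' d L) (h52 : pdev (perCfg (towerP L m k) U) < α₀ * (((L : ℝ) ^ k)⁻¹) ^ 2)
  (hlev : ∀ b, k ≤ lev₀ b)
  -- [4] Prop. 4's regime for the (115)-ball radius `ρ` (analyticity of `C_k` on the ball, as in `B11Eq44CKernelColumnTower`)
  {ρ : ℝ} (hρ0 : 0 < ρ)
  (hρ : Real.exp (4 * (800 * ((d : ℝ) + 1) ^ 2 * ((d : ℝ) + 4)) * α₀) * (1 + 8 * (131072 * ((d : ℝ) + 1) ^ 2) * ρ) ≤ 2)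
  -- Prop. 7's regime in the background variable `ρ′` and Prop. 5's complex regime at the field size `ρ∕Lᵏ` (the hypotheses of `B7Prop7KernelBackgroundModulusLevels`)
  {ρ' : ℝ} (hρ' : 0 < ρ')
  (hsmall' : Real.exp (4 * (800 * ((d : ℝ) + 1) ^ 2 * ((d : ℝ) + 4)) * α₀)
    * (1 + 8 * (131072 * ((d : ℝ) + 1) ^ 2) * ((L : ℝ) ^ k * ρ')) ≤ 2)
  (hc₃' : 2 * ((L : ℝ) ^ k * ρ') ≤ c3 d L) (hρ'1 : 409600 * ((d : ℝ) + 1) ^ 2 * ((L : ℝ) ^ k * ρ') ≤ 1)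
  (hE : epsCplx d L ρ' k ≤ 1 / 16) (hdX : (d : ℝ) * (epsCplx d L ρ' k + tauCplx d L α₀ k ρ' k) ≤ 1 / 16)
  (hsmall : Real.exp (4480 * ((d : ℝ) + 1) ^ 2 * ((d : ℝ) + 4) * α₀ + 240000 * ((d : ℝ) + 1) ^ 3 * ((L : ℝ) ^ k * ρ'))
    * (1 + 8 * (2097152 * ((d : ℝ) + 1) ^ 2) * ((L : ℝ) ^ k * (ρ / (L : ℝ) ^ k))) ≤ 2)
  (hc₃ : 16 * ((L : ℝ) ^ k * (ρ / (L : ℝ) ^ k)) < c3 d L) (hβ : (d : ℝ) * C3Cplx d L * ((L : ℝ) ^ k * (ρ / (L : ℝ) ^ k)) ≤ 1)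

include hL hG hU hα hα3 hα8 h52 hlev hρ0 hρ hρ' hsmall' hc₃' hρ'1 hE hdX hsmall hc₃ hβ in
/-- **THE KERNEL LETTER OF `C_k` BETWEEN TWO CARRIERS, PER ENTRY** — see the module docstring: for `‖Y‖ < ρ` (carrier of `∇_U`), `‖Y′‖ ≤ ρ∕2` (carrier of `∇_1`), the background window
`‖U(b) − 1‖ ≤ αη` with `6αη ≤ ρ′`, and the field defect `η·sup_b‖A₁(b) − A₂(b)‖ ≤ δ_f` (`A₁, A₂` the bond functions of `Y, Y′`):
`‖(DC_k(U)(Y)·Xδ_b)(c) − (DC_k(1)(Y′)·Xδ_b)(c)‖ ≤ ((6∕(Lᵏρ′))(Lᵏ(αη)) + (24∕(ρ∕Lᵏ))δ_f)·C₃(Lᵏ)²(ρ∕Lᵏ)(η‖X‖)·Σ_{t∈{0,1}^d} kerQdd(c̃; x̃ + Pt, μ)`.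
[cite: Balaban1985Averaging, Prop. 5 (157) p.42, (141) p.39, Proposition 7 p.43; Balaban1985Variational, (44) p.285, (73) p.289, (117) p.295] -/
theorem norm_fderiv_Cck_sub_flat_single_apply_le {Y : Space115 (L : ℝ) η lev₀ lev₁ Dc₁} (hY : ‖Y‖ < ρ)
    {Y' : Space115 (L : ℝ) η lev₀ lev₁ Dc₂} (hY' : ‖Y'‖ ≤ ρ / 2)
    {α : ℝ} (hα0 : 0 ≤ α) (hUη : ∀ bd : Bond d (towerP L m k), ‖(U bd : 𝔸) - 1‖ ≤ α * η) (hαρ : 6 * (α * η) ≤ ρ')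
    {δf : ℝ} (hδf0 : 0 ≤ δf)
    (hδf : ∀ bd : Bond d (towerP L m k), η * ‖JetSup.equiv (levWeight (L : ℝ) η lev₀ 1) (levWeight (L : ℝ) η lev₁ 2) Dc₁ Y bd -
      JetSup.equiv (levWeight (L : ℝ) η lev₀ 1) (levWeight (L : ℝ) η lev₁ 2) Dc₂ Y' bd‖ ≤ δf)
    (b : Bond d (towerP L m k)) (X : 𝔸) (c : Bond d m) :
    ‖NegSup.equiv (levWeight (L : ℝ) η levB 0) 𝔸 (fderiv ℂ (Cck L m η k U lev₀ lev₁ Dc₁ levB) Y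
          (single115 (L := (L : ℝ)) (η := η) (lev₀ := lev₀) (lev₁ := lev₁) (Dc := Dc₁) b X)) c -
      NegSup.equiv (levWeight (L : ℝ) η levB 0) 𝔸 (fderiv ℂ (Cck L m η k (fun _ : Bond d (towerP L m k) => (1 : 𝔸ˣ)) lev₀ lev₁ Dc₂ levB) Y'
          (single115 (L := (L : ℝ)) (η := η) (lev₀ := lev₀) (lev₁ := lev₁) (Dc := Dc₂) b X)) c‖ ≤
      (6 / ((L : ℝ) ^ k * ρ') * ((L : ℝ) ^ k * (α * η)) + 24 / (ρ / (L : ℝ) ^ k) * δf) *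
        (C3Cplx d L * ((L : ℝ) ^ k) ^ 2 * (ρ / (L : ℝ) ^ k) * (η * ‖X‖)) *
        (∑ t ∈ (Fintype.piFinset fun _ : Fin d => ({0, 1} : Finset ℤ)), kerQdd L k (liftSite c.1) c.2 (liftSite b.1 + periodVec (towerP L m k) t) b.2) := by
  classical
  have hL1 : 1 ≤ L := le_trans (by norm_num) hL
  have hL1r : (1 : ℝ) ≤ L := by exact_mod_cast hL1
  have hLk : (0 : ℝ) < (L : ℝ) ^ k := by positivity
  have hη0 : 0 < η := Fact.out
  have hα4 : 4 * α₀ ≤ c2' d L := by linarith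
  have hC30 : 0 ≤ C3Cplx d L := (B7Prop5CplxLevels.C3Cplx_pos d hL1).le
  -- the field size `b := ρ∕Lᵏ` and the regime of [4] Prop. 4 at the two points
  set bf : ℝ := ρ / (L : ℝ) ^ k with hbf
  have hbf0 : 0 < bf := by rw [hbf]; positivity
  have hLbf : (L : ℝ) ^ k * bf = ρ := by rw [hbf]; field_simp
  have hc₃ρ : 2 * ρ ≤ c3 d L := by rw [hLbf] at hc₃; linarith
  set A₁ : Bond d (towerP L m k) → 𝔸 := JetSup.equiv (levWeight (L : ℝ) η lev₀ 1) (levWeight (L : ℝ) η lev₁ 2) Dc₁ Y with hA₁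
  set A₂ : Bond d (towerP L m k) → 𝔸 := JetSup.equiv (levWeight (L : ℝ) η lev₀ 1) (levWeight (L : ℝ) η lev₁ 2) Dc₂ Y' with hA₂
  have hAa₁ : ∀ b', η * ‖A₁ b'‖ ≤ ‖Y‖ / (L : ℝ) ^ k :=
    eta_mul_norm_le_of_weight_k L m η k lev₀ hlev hL1r hη0.le A₁ (fun b' => JetSup.weight_mul_norm_apply_le Y b')
  have hAa₂ : ∀ b', η * ‖A₂ b'‖ ≤ ‖Y'‖ / (L : ℝ) ^ k :=
    eta_mul_norm_le_of_weight_k L m η k lev₀ hlev hL1r hη0.le A₂ (fun b' => JetSup.weight_mul_norm_apply_le Y' b')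
  have ha₁ : 0 ≤ ‖Y‖ / (L : ℝ) ^ k := by positivity
  have ha₂ : 0 ≤ ‖Y'‖ / (L : ℝ) ^ k := by positivity
  have hLa₁ : (L : ℝ) ^ k * (‖Y‖ / (L : ℝ) ^ k) = ‖Y‖ := mul_div_cancel₀ _ hLk.ne'
  have hLa₂ : (L : ℝ) ^ k * (‖Y'‖ / (L : ℝ) ^ k) = ‖Y'‖ := mul_div_cancel₀ _ hLk.ne'
  have hY'ρ : ‖Y'‖ < ρ := by linarith
  have hsmall₁ : Real.exp (4 * (800 * ((d : ℝ) + 1) ^ 2 * ((d : ℝ) + 4)) * α₀) *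
      (1 + 8 * (131072 * ((d : ℝ) + 1) ^ 2) * ((L : ℝ) ^ k * (‖Y‖ / (L : ℝ) ^ k))) ≤ 2 := by rw [hLa₁]; exact smallness_mono hY.le hρ
  have hsmall₂ : Real.exp (4 * (800 * ((d : ℝ) + 1) ^ 2 * ((d : ℝ) + 4)) * α₀) *
      (1 + 8 * (131072 * ((d : ℝ) + 1) ^ 2) * ((L : ℝ) ^ k * (‖Y'‖ / (L : ℝ) ^ k))) ≤ 2 := by rw [hLa₂]; exact smallness_mono hY'ρ.le hρ
  have hc₃₁ : 2 * ((L : ℝ) ^ k * (‖Y‖ / (L : ℝ) ^ k)) ≤ c3 d L := by rw [hLa₁]; linarith [norm_nonneg Y]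
  have hc₃₂ : 2 * ((L : ℝ) ^ k * (‖Y'‖ / (L : ℝ) ^ k)) ≤ c3 d L := by rw [hLa₂]; linarith [norm_nonneg Y']
  -- the data of the vacuum
  have e1 : perCfg (towerP L m k) (fun _ : Bond d (towerP L m k) => (1 : 𝔸ˣ)) = 1 := perCfg_const_one L m k
  have hU₁ : ∀ (x : Site d) (κ : Fin d), perCfg (towerP L m k) (fun _ : Bond d (towerP L m k) => (1 : 𝔸ˣ)) x κ ∈ G := fun _ _ => G.one_mem
  have h52₁ : pdev (perCfg (towerP L m k) (fun _ : Bond d (towerP L m k) => (1 : 𝔸ˣ))) < α₀ * (((L : ℝ) ^ k)⁻¹) ^ 2 := by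
    rw [e1]
    have hpdev : pdev (1 : Site d → Fin d → 𝔸ˣ) = 0 := by unfold pdev; simp [hol_one]
    rw [hpdev]; positivity
  -- the two entries are the Fréchet partials of the torus block maps (as in `B11Eq44CKernelColumnTower`)
  have hentry : ∀ {Dc : (Bond d (towerP L m k) → 𝔸) →ₗ[ℂ] (κ' → 𝔸)} (V : Bond d (towerP L m k) → 𝔸ˣ)
      (hV : ∀ (x : Site d) (κ : Fin d), perCfg (towerP L m k) V x κ ∈ G) (h52V : pdev (perCfg (towerP L m k) V) < α₀ * (((L : ℝ) ^ k)⁻¹) ^ 2)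
      (Z : Space115 (L : ℝ) η lev₀ lev₁ Dc) (hZ : ‖Z‖ < ρ)
      (hsmallZ : Real.exp (4 * (800 * ((d : ℝ) + 1) ^ 2 * ((d : ℝ) + 4)) * α₀) *
        (1 + 8 * (131072 * ((d : ℝ) + 1) ^ 2) * ((L : ℝ) ^ k * (‖Z‖ / (L : ℝ) ^ k))) ≤ 2) (hc₃Z : 2 * ((L : ℝ) ^ k * (‖Z‖ / (L : ℝ) ^ k)) ≤ c3 d L),
      NegSup.equiv (levWeight (L : ℝ) η levB 0) 𝔸 (fderiv ℂ (Cck L m η k V lev₀ lev₁ Dc levB) Z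
          (single115 (L := (L : ℝ)) (η := η) (lev₀ := lev₀) (lev₁ := lev₁) (Dc := Dc) b X)) c =
        fderiv ℂ (fun A' : Bond d (towerP L m k) → 𝔸 => Cblockk L m η k V A' c)
          (JetSup.equiv (levWeight (L : ℝ) η lev₀ 1) (levWeight (L : ℝ) η lev₁ 2) Dc Z) (Pi.single b X) := by
    intro Dc V hV h52V Z hZ hsmallZ hc₃Z
    have hAZ : ∀ b', η * ‖JetSup.equiv (levWeight (L : ℝ) η lev₀ 1) (levWeight (L : ℝ) η lev₁ 2) Dc Z b'‖ ≤ ‖Z‖ / (L : ℝ) ^ k :=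
      eta_mul_norm_le_of_weight_k L m η k lev₀ hlev hL1r hη0.le _ (fun b' => JetSup.weight_mul_norm_apply_le Z b')
    set Fl : Space115 (L : ℝ) η lev₀ lev₁ Dc →L[ℂ] (Bond d (towerP L m k) → 𝔸) :=
      ContinuousLinearMap.pi fun b' => JetSup.evalCLM (levWeight (L : ℝ) η lev₀ 1) (levWeight (L : ℝ) η lev₁ 2) Dc b' with hFl
    have hFlb : Fl (single115 (L := (L : ℝ)) (η := η) (lev₀ := lev₀) (lev₁ := lev₁) (Dc := Dc) b X) = Pi.single b X := rfl
    have hcomp : (fun Z' : Space115 (L : ℝ) η lev₀ lev₁ Dc => NegSup.equiv (levWeight (L : ℝ) η levB 0) 𝔸 (Cck L m η k V lev₀ lev₁ Dc levB Z') c) =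
        (fun A' : Bond d (towerP L m k) → 𝔸 => Cblockk L m η k V A' c) ∘ Fl := rfl
    have hCck : DifferentiableAt ℂ (Cck L m η k V lev₀ lev₁ Dc levB) Z :=
      (analyticOnNhd_Cck L m η k V lev₀ lev₁ Dc levB hL hG hV hα hα3 hα4 h52V hlev hρ (by linarith [norm_nonneg Z]) Z hZ).differentiableAt
    have hGd : DifferentiableAt ℂ (fun A' : Bond d (towerP L m k) → 𝔸 => Cblockk L m η k V A' c) (Fl Z) :=
      (analyticAt_Cblockk L m η k V hL hG hV hα hα3 hα4 h52V hη0.le _ (by positivity) hAZ hsmallZ hc₃Z c).differentiableAt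
    have h1 : fderiv ℂ ((NegSup.evalCLM ℂ (levWeight (L : ℝ) η levB 0) c) ∘ Cck L m η k V lev₀ lev₁ Dc levB) Z =
        (NegSup.evalCLM ℂ (levWeight (L : ℝ) η levB 0) c).comp (fderiv ℂ (Cck L m η k V lev₀ lev₁ Dc levB) Z) :=
      ((NegSup.evalCLM ℂ (levWeight (L : ℝ) η levB 0) c).hasFDerivAt.comp Z hCck.hasFDerivAt).fderiv
    have h2 : fderiv ℂ (fun Z' => NegSup.equiv (levWeight (L : ℝ) η levB 0) 𝔸 (Cck L m η k V lev₀ lev₁ Dc levB Z') c) Z =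
        (fderiv ℂ (fun A' : Bond d (towerP L m k) → 𝔸 => Cblockk L m η k V A' c) (Fl Z)).comp Fl := by
      rw [hcomp]
      exact (hGd.hasFDerivAt.comp Z Fl.hasFDerivAt).fderiv
    have h12 : (NegSup.evalCLM ℂ (levWeight (L : ℝ) η levB 0) c).comp (fderiv ℂ (Cck L m η k V lev₀ lev₁ Dc levB) Z) =
        (fderiv ℂ (fun A' : Bond d (towerP L m k) → 𝔸 => Cblockk L m η k V A' c) (Fl Z)).comp Fl := h1.symm.trans h2
    have h3 := congrArg (fun T => T (single115 (L := (L : ℝ)) (η := η) (lev₀ := lev₀) (lev₁ := lev₁) (Dc := Dc) b X)) h12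
    simp only [ContinuousLinearMap.comp_apply, NegSup.evalCLM_apply, hFlb] at h3
    exact h3
  rw [hentry U hU h52 Y hY hsmall₁ hc₃₁, hentry (fun _ => 1) hU₁ h52₁ Y' hY'ρ hsmall₂ hc₃₂,
    fderiv_Cblockk_single L m η k U hL hG hU hα hα3 hα4 h52 hη0 A₁ ha₁ hAa₁ hsmall₁ hc₃₁ b X c,
    fderiv_Cblockk_single L m η k (fun _ => 1) hL hG hU₁ hα hα3 hα4 h52₁ hη0 A₂ ha₂ hAa₂ hsmall₂ hc₃₂ b X c, e1, ← Finset.sum_sub_distrib]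
  -- the two fields on `ℤ^d` and the background: sizes, defect, window
  have hB₁ : ∀ x κ, ‖perCfg (towerP L m k) ((η : ℂ) • A₁) x κ‖ ≤ bf := fun x κ =>
    (norm_perCfg_smul_le L m η k hη0.le A₁ hAa₁ x κ).trans (by rw [hbf]; exact div_le_div_of_nonneg_right hY.le hLk.le)
  have hB₂ : ∀ x κ, ‖perCfg (towerP L m k) ((η : ℂ) • A₂) x κ‖ ≤ bf / 2 := fun x κ =>
    (norm_perCfg_smul_le L m η k hη0.le A₂ hAa₂ x κ).trans (by
      rw [show bf / 2 = ρ / 2 / (L : ℝ) ^ k by rw [hbf]; ring]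
      exact div_le_div_of_nonneg_right hY' hLk.le)
  have hB₁₂ : ∀ x κ, ‖perCfg (towerP L m k) ((η : ℂ) • A₁) x κ - perCfg (towerP L m k) ((η : ℂ) • A₂) x κ‖ ≤ δf := fun x κ => by
    simp only [perCfg_apply, Pi.smul_apply, ← smul_sub, norm_smul, Complex.norm_real, Real.norm_of_nonneg hη0.le]
    exact hδf _
  have hVε : ∀ x κ, ‖((perCfg (towerP L m k) U x κ : 𝔸ˣ) : 𝔸) - 1‖ ≤ α * η := fun x κ => by rw [perCfg_apply]; exact hUη _
  have hεα : 0 ≤ α * η := mul_nonneg hα0 hη0.le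
  -- the regime of `B7Prop7KernelBackgroundModulusLevels` at `b := bf`
  have hsmallbf : Real.exp (4480 * ((d : ℝ) + 1) ^ 2 * ((d : ℝ) + 4) * α₀ + 240000 * ((d : ℝ) + 1) ^ 3 * ((L : ℝ) ^ k * ρ'))
      * (1 + 8 * (2097152 * ((d : ℝ) + 1) ^ 2) * ((L : ℝ) ^ k * bf)) ≤ 2 := hsmall
  have hc₃bf : 16 * ((L : ℝ) ^ k * bf) < c3 d L := hc₃
  have hβbf : (d : ℝ) * C3Cplx d L * ((L : ℝ) ^ k * bf) ≤ 1 := hβ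
  -- per image: the background part + the field part, zero off the box
  set M : ℝ := C3Cplx d L * ((L : ℝ) ^ k) ^ 2 * (((L : ℝ) ^ k) ^ d)⁻¹ * bf * ‖(η : ℂ) • X‖ with hMdef
  have hηX : ‖(η : ℂ) • X‖ = η * ‖X‖ := by rw [norm_smul, Complex.norm_real, Real.norm_of_nonneg hη0.le]
  have hker : ∀ s : Site d, ‖dCov L (perCfg (towerP L m k) U) (perCfg (towerP L m k) ((η : ℂ) • A₁))
        (bump (liftSite b.1 + periodVec (towerP L m k) s) b.2 ((η : ℂ) • X)) k (liftSite c.1) c.2 -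
        dCov L 1 (perCfg (towerP L m k) ((η : ℂ) • A₂)) (bump (liftSite b.1 + periodVec (towerP L m k) s) b.2 ((η : ℂ) • X)) k (liftSite c.1) c.2‖ ≤
      (6 / ((L : ℝ) ^ k * ρ') * ((L : ℝ) ^ k * (α * η)) + 24 / bf * δf) * (C3Cplx d L * ((L : ℝ) ^ k) ^ 2 * bf * (η * ‖X‖)) *
        kerQdd L k (liftSite c.1) c.2 (liftSite b.1 + periodVec (towerP L m k) s) b.2 := by
    intro s
    by_cases hin : BondIn (loK L k (liftSite c.1)) (bondHiK L k (liftSite c.1) c.2) (liftSite b.1 + periodVec (towerP L m k) s) b.2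
    · have h1 := norm_dCov_sub_flat_le L hL hG k hα hα3 hα8 hρ' hbf0 hsmall' hc₃' hρ'1 hE hdX hsmallbf hc₃bf hβbf (perCfg (towerP L m k) U) hεα hVε hαρ
        (perCfg (towerP L m k) ((η : ℂ) • A₁)) hB₁ (liftSite b.1 + periodVec (towerP L m k) s) b.2 ((η : ℂ) • X) (liftSite c.1) c.2
      have h2 := norm_dCov_flat_sub_le L hL hG k hα hα3 hα8 hρ' hbf0 hsmall' hc₃' hρ'1 hE hdX hsmallbf hc₃bf hβbf
        (perCfg (towerP L m k) ((η : ℂ) • A₁)) (perCfg (towerP L m k) ((η : ℂ) • A₂)) hB₁ hB₂ hδf0 hB₁₂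
        (liftSite b.1 + periodVec (towerP L m k) s) b.2 ((η : ℂ) • X) (liftSite c.1) c.2
      rw [kerQdd_of_bondIn hin]
      calc _ ≤ ‖dCov L (perCfg (towerP L m k) U) (perCfg (towerP L m k) ((η : ℂ) • A₁)) (bump (liftSite b.1 + periodVec (towerP L m k) s) b.2 ((η : ℂ) • X)) k (liftSite c.1) c.2 -
              dCov L 1 (perCfg (towerP L m k) ((η : ℂ) • A₁)) (bump (liftSite b.1 + periodVec (towerP L m k) s) b.2 ((η : ℂ) • X)) k (liftSite c.1) c.2‖ +
            ‖dCov L 1 (perCfg (towerP L m k) ((η : ℂ) • A₁)) (bump (liftSite b.1 + periodVec (towerP L m k) s) b.2 ((η : ℂ) • X)) k (liftSite c.1) c.2 -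
              dCov L 1 (perCfg (towerP L m k) ((η : ℂ) • A₂)) (bump (liftSite b.1 + periodVec (towerP L m k) s) b.2 ((η : ℂ) • X)) k (liftSite c.1) c.2‖ :=
            norm_sub_le_norm_sub_add_norm_sub _ _ _
        _ ≤ 6 / ((L : ℝ) ^ k * ρ') * ((L : ℝ) ^ k * (α * η)) * M + 24 / bf * δf * M := add_le_add h1 h2
        _ = _ := by rw [hMdef, hηX]; ring
    · have z₁ := dCov_sub_flat_eq_zero_off L hL hG k hα hα3 hα8 hρ' hbf0 hsmall' hc₃' hρ'1 hE hdX hsmallbf hc₃bf hβbf (perCfg (towerP L m k) U) hεα hVε hαρ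
        (perCfg (towerP L m k) ((η : ℂ) • A₁)) hB₁ (liftSite b.1 + periodVec (towerP L m k) s) b.2 ((η : ℂ) • X) (liftSite c.1) c.2 hin
      have z₂ := dCov_flat_eq_zero_off L hL hG k hα hα3 hα8 hρ' hbf0 hsmall' hc₃' hρ'1 hE hdX hsmallbf hc₃bf hβbf
        (perCfg (towerP L m k) ((η : ℂ) • A₁)) hB₁ (liftSite b.1 + periodVec (towerP L m k) s) b.2 ((η : ℂ) • X) (liftSite c.1) c.2 hin
      have z₃ := dCov_flat_eq_zero_off L hL hG k hα hα3 hα8 hρ' hbf0 hsmall' hc₃' hρ'1 hE hdX hsmallbf hc₃bf hβbf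
        (perCfg (towerP L m k) ((η : ℂ) • A₂)) (fun x κ => (hB₂ x κ).trans (by linarith)) (liftSite b.1 + periodVec (towerP L m k) s) b.2 ((η : ℂ) • X)
        (liftSite c.1) c.2 hin
      rw [sub_eq_zero.1 z₁] at *
      rw [z₂, z₃, sub_self, norm_zero, kerQdd_of_not_bondIn hin, mul_zero]
  calc _ ≤ ∑ s ∈ (Fintype.piFinset fun _ : Fin d => ({0, 1} : Finset ℤ)),
          ‖dCov L (perCfg (towerP L m k) U) (perCfg (towerP L m k) ((η : ℂ) • A₁)) (bump (liftSite b.1 + periodVec (towerP L m k) s) b.2 ((η : ℂ) • X)) k (liftSite c.1) c.2 -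
            dCov L 1 (perCfg (towerP L m k) ((η : ℂ) • A₂)) (bump (liftSite b.1 + periodVec (towerP L m k) s) b.2 ((η : ℂ) • X)) k (liftSite c.1) c.2‖ :=
        norm_sum_le _ _
    _ ≤ ∑ s ∈ (Fintype.piFinset fun _ : Fin d => ({0, 1} : Finset ℤ)),
          (6 / ((L : ℝ) ^ k * ρ') * ((L : ℝ) ^ k * (α * η)) + 24 / bf * δf) * (C3Cplx d L * ((L : ℝ) ^ k) ^ 2 * bf * (η * ‖X‖)) *
            kerQdd L k (liftSite c.1) c.2 (liftSite b.1 + periodVec (towerP L m k) s) b.2 := Finset.sum_le_sum fun s _ => hker s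
    _ = _ := by rw [← Finset.mul_sum]

end Letter

end Literature.MathematicalPhysics.QuantumFieldTheory.Balaban1983to89.B11Eq44CKernelTowerTwoBackgrounds

end
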